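import Summits.QuantumFields.BalabanUV.Beta.FP.ExpLocalisedBubblePoint

/-!
# `BalabanUV.Beta.FP.ExpLocalisedBubbleProduct` — road «FP», N7 H-route, row H2-a: THE PRODUCT-WEIGHT CASE `c(x,y) = v(x)·v′(y)` (the bubble's two vertex
# stencils) — the total mass and the first moments FACTOR: `Σ'c = (Σ'v)(Σ'v′)`, `m_i = (Σ' x_i·v)(Σ'v′) − (Σ'v)(Σ' y_i·v′)`, and the point expansions of
# `FP/ExpLocalisedBubblePoint` read in that currency ([folklore]; nothing of the manuscripts)

HONEST DEPENDENCY (page 1, mandatory): continuum YM on T⁴ ⇐ BetaPertH ∧ nine spine estimates (0/9 proved); BetaPertH ⇐ (D1) ∧ (D4) ∧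
CAP+tail; G-an2-4 gates asym, D1 and NE2/3/4.  HONEST FRAMING (cell contract, verbatim): «discharging `BetaPertH` makes Bałaban's UV
stability UNCONDITIONAL — a real constructive-QFT result; it is NOT the continuum limit and NOT the Clay problem.»  THIS MODULE is wiring over
`FP/ExpLocalisedBubblePoint` (leaf-02 g6) and `FP/HorizontalBookkeepingTail.hasSum_mul`; every analytic input is a HYPOTHESIS; no `def`, no `Prop` fact, 0 sorry.
NOT the perfect theory's bubble, NOT `hgerm`, NOT `hasym`, NOT D1, NOT BetaPertH, NOT continuum, NOT Clay.

CONTENT: `loc_of_product` (product of one-point exponential profiles is a two-point localised weight with `C := C₁·C₂`), `tsum_product_weight`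
(`Σ'_{x,y} v x·v′ y = (Σ'v)(Σ'v′)`), `firstMoment_product` (`Σ'_{x,y} v x·v′ y·(x−y)_i = (Σ' x_i·v x)(Σ'v′) − (Σ'v)(Σ' y_i·v′ y)`),
**`abs_smear_product_sub_order1_le_point`**, **`abs_smear_product_sub_order0_le_point`** (the point expansions with these factored data).
Unit `b2b-balaban-beta-d1-formalise-leaf-02` (gen 6).
-/

noncomputable section

namespace Summit.QuantumFields.BalabanUV.Beta.FP.ExpLocalisedBubbleProduct

open Finset Filter Topology fwdDiff
open scoped BigOperators
open Literature.MathematicalPhysics.QuantumFieldTheory.Balaban1983to89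
open Literature.MathematicalPhysics.QuantumFieldTheory.Balaban1983to89.Beta
open B12Sec2to5 (l1 l1_nonneg abs_coord_le_l1)
open ExpKernelCalculus (Site Zl Zl_pos)
open Summit.QuantumFields.BalabanUV.Beta.FP.StencilMoments (summable_of_weight_exp)
open Summit.QuantumFields.BalabanUV.Beta.FP.HorizontalBookkeepingTail (hasSum_mul)
open Summit.QuantumFields.BalabanUV.Beta.FP.ExpLocalisedBubble
open Summit.QuantumFields.BalabanUV.Beta.FP.ExpLocalisedBubblePoint
open DyadicShell (Pt supNorm)

variable {D : ℕ}

/-- [folklore] The product of two one-point exponential profiles is a two-point localised weight with constant `C₁·C₂`. -/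
theorem loc_of_product {v v' : Site D → ℝ} {C₁ C₂ δ : ℝ} (hv : ∀ x, |v x| ≤ C₁ * Real.exp (-δ * l1 x)) (hv' : ∀ y, |v' y| ≤ C₂ * Real.exp (-δ * l1 y)) :
    ∀ p : Site D × Site D, |v p.1 * v' p.2| ≤ (C₁ * C₂) * (Real.exp (-δ * l1 p.1) * Real.exp (-δ * l1 p.2)) := by
  intro p
  have hC₁ : 0 ≤ C₁ := by
    have h := hv 0
    have e : l1 (0 : Site D) = 0 := by unfold l1; simp
    rw [e, mul_zero, Real.exp_zero, mul_one] at h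
    exact (abs_nonneg _).trans h
  rw [abs_mul]
  calc |v p.1| * |v' p.2| ≤ (C₁ * Real.exp (-δ * l1 p.1)) * (C₂ * Real.exp (-δ * l1 p.2)) :=
        mul_le_mul (hv p.1) (hv' p.2) (abs_nonneg _) (by positivity)
    _ = (C₁ * C₂) * (Real.exp (-δ * l1 p.1) * Real.exp (-δ * l1 p.2)) := by ring

/-- [folklore] An exponential profile is absolutely summable together with its first moments. -/
theorem summable_abs_of_profile {v : Site D → ℝ} {C₁ δ : ℝ} (hδ : 0 < δ) (hv : ∀ x, |v x| ≤ C₁ * Real.exp (-δ * l1 x)) :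
    (Summable fun x => |v x|) ∧ ∀ i : Fin D, Summable fun x => |(x i : ℝ) * v x| := by
  have hC₁ : 0 ≤ C₁ := by
    have h := hv 0
    have e : l1 (0 : Site D) = 0 := by unfold l1; simp
    rw [e, mul_zero, Real.exp_zero, mul_one] at h
    exact (abs_nonneg _).trans h
  have h0 := (summable_of_weight_exp (q := (0 : Site D)) (k := 0) hδ hC₁ (g := v) (fun x => by
    rw [sub_zero, pow_zero, mul_one]; exact hv x)).1
  refine ⟨h0.abs, fun i => ?_⟩
  have h1 := (summable_of_weight_exp (q := (0 : Site D)) (k := 1) hδ hC₁ (g := fun x => (x i : ℝ) * v x) (fun x => by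
    rw [sub_zero, pow_one, abs_mul]
    calc |(x i : ℝ)| * |v x| ≤ (l1 x + 1) * (C₁ * Real.exp (-δ * l1 x)) :=
          mul_le_mul ((abs_coord_le_l1 x i).trans (by linarith)) (hv x) (abs_nonneg _) (by linarith [l1_nonneg x])
      _ = C₁ * (l1 x + 1) * Real.exp (-δ * l1 x) := by ring)).1
  exact h1.abs

/-- **THE TOTAL MASS FACTORS**: `Σ'_{x,y} v x·v′ y = (Σ'v)·(Σ'v′)`. [folklore] -/
theorem tsum_product_weight {v v' : Site D → ℝ} {C₁ C₂ δ : ℝ} (hδ : 0 < δ) (hv : ∀ x, |v x| ≤ C₁ * Real.exp (-δ * l1 x))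
    (hv' : ∀ y, |v' y| ≤ C₂ * Real.exp (-δ * l1 y)) :
    ∑' p : Site D × Site D, v p.1 * v' p.2 = (∑' x, v x) * (∑' y, v' y) :=
  (hasSum_mul (summable_abs_of_profile hδ hv).1 (summable_abs_of_profile hδ hv').1).tsum_eq

/-- **THE FIRST MOMENTS FACTOR**: `Σ'_{x,y} v x·v′ y·(x−y)_i = (Σ' x_i·v x)·(Σ'v′) − (Σ'v)·(Σ' y_i·v′ y)`. [folklore] -/
theorem firstMoment_product {v v' : Site D → ℝ} {C₁ C₂ δ : ℝ} (hδ : 0 < δ) (hv : ∀ x, |v x| ≤ C₁ * Real.exp (-δ * l1 x))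
    (hv' : ∀ y, |v' y| ≤ C₂ * Real.exp (-δ * l1 y)) (i : Fin D) :
    ∑' p : Site D × Site D, v p.1 * v' p.2 * ((p.1 - p.2) i : ℝ)
      = (∑' x, (x i : ℝ) * v x) * (∑' y, v' y) - (∑' x, v x) * (∑' y, (y i : ℝ) * v' y) := by
  obtain ⟨hva, hvi⟩ := summable_abs_of_profile hδ hv
  obtain ⟨hv'a, hv'i⟩ := summable_abs_of_profile hδ hv'
  have H1 := hasSum_mul (w := fun x => (x i : ℝ) * v x) (w' := v') (hvi i) hv'a
  have H2 := hasSum_mul (w := v) (w' := fun y => (y i : ℝ) * v' y) hva (hv'i i)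
  have H := H1.sub H2
  exact (H.congr_fun fun p => by rw [Pi.sub_apply, Int.cast_sub]; ring).tsum_eq

end Summit.QuantumFields.BalabanUV.Beta.FP.ExpLocalisedBubbleProduct

end
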